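import Summits.FinalStateConjecture.FinalStateConjecture.Theses.KillingDefectSpacetimeBound
import HarnessLib

/-!
# Birth skeleton — crux stmt-FinalStateConjecture-18631 `Theses.KillingDefectSpacetimeBound.DefectObservability` (crux, rank 3)
# line `birth` (skeleton registrar planner-skel-stmt-FinalStateConjecture-18631-0, 2026-08-17; BC3 of run/shared/lean/lens3/_common/BC.md)

The crux (rev 0, verbatim the route decl `DefectObservability`, K2 "backward observability of the stationarity
defect"): there is `k₂` such that for `k ≥ k₂` and all `(Λ, χ, M₀, a₀)` there are `δ₀ > 0` and `C` with: on any
hyperboloidal Kerr-star foliation `Ψ` of order `k` of a vacuum development (`IsHypKerrFoliation k Λ χ M₀ a₀ τ₀ Ψ`)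
and any window `[τ₁, τ₂]`, `τ₀ ≤ τ₁`, `τ₁ + 1 ≤ τ₂`, on which the leaf deviation `leafDev … k τ ≤ δ₀`, the LE size of
order `k` of the stationarity defect `π = ∂₀(Ψ^* g) = chartMetricDt` over the MIDDLE zone `(Kerr.outerZones M₀ a₀)ᶜ`
of the window is `≤ C ×` its LE size of order `k + 2` over the OUTER zones of the whole future `(τ₁, ∞)`.

THE CUT (two named stubs = the route's own TWO-LAYER PLAN "DefectObservability ⇐ stub_defect_wave →
stub_backward_LE", typed; dictionary first, analysis second):

* `stub_defectIsDeformation` (S/M — an index computation in `MetricCoord`, no analysis): for the components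
  `G` of a metric on an open `V ⊆ E4` (`MetricCoord.IsMetricOn G V`), the `e₀`-derivative of the components IS
  the deformation tensor of the time covector `T = G(e₀, ·) = (∂₀)♭` in the standard basis:
  `∂₀ g_{ji} = (tcov T)_{ji} + (tcov T)_{ij} = (𝓛_{∂₀} g)_{ji}`.  Instantiated at `G = chartMetricExtend B Ψ`,
  `V = val '' lateRegion τ₀` this says, definitionally, `chartMetricDt B Ψ x e_j e_i = deform G b (timeCovector B Ψ) x (j,i)`.
  Proof route (all in tree): `IsMetricOn.deform_covecComp` (`deform (covecComp Θ) = kdef Θ` on basis vectors) with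
  `Θ y := G y e₀`; `kdef_apply`; `apply_chrAt` + `koszulCLM_apply` (`2 G(Γ(X,Y), e₀) = ∂_X g(Y,e₀) + ∂_Y g(e₀,X) − ∂₀ g(X,Y)`);
  `IsMetricOn.symm` and `IsMetricOn.fderiv_symm` cancel the four first-order terms.  Wald 1984 (C.2.16); O'Neill 1983,
  Ch. 3, Prop. 3.13; Fischer–Marsden–Moncrief 1980, §2 (`h = 𝓛_X g`).
* `stub_gaugeDefectObservability` (XL — the whole analytic content; hardest stub): BACKWARD LOCAL-ENERGY OBSERVABILITY
  FOR PURE-GAUGE DEFORMATION TENSORS.  Same quantifier frame and constants as the crux, but the field is generalised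
  from `π` to ANY smooth `u : E4 → E4 →L E4 →L ℝ` whose standard-basis components are the deformation tensor
  `deform G b T` of SOME smooth covector field `T` in wave gauge `□_G T = 0` (`MetricCoord.tlap … T = 0`) on the late
  region, `G = Ψ^* g` the chart metric: then `∫_{window ∩ middle} leSqDensity k u ≤ C ∫_{future ∩ outer} leSqDensity (k+2) u`.
  By Fischer–Marsden–Moncrief 1980, Lemma 2.2 — in tree as `MetricCoord.IsMetricOn.tlap_deform_eq_of_tlap_eq_zero`,
  with the harmonic-gauge identity `IsMetricOn.trace_tcov_deform_sub_half` and vacuum `ricAt (chartMetricExtend B Ψ) = 0`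
  (landed: `Theorems.ClusterCompleteness.ricAt_chartMetricExtend_eq_zero`) — such `A = deform T` solve the Lichnerowicz
  system `□A = −(X + Xᵗ)·A` in harmonic gauge, i.e. they are the pure-gauge solutions of linearised vacuum gravity about
  the near-Kerr chart metric; the stub is the two-sided (event-horizon shell + far zone) backward LE observability
  estimate for them, losing two derivatives at trapping.  A prover may of course prove the STRONGER statement for all
  harmonic-gauge solutions of the Lichnerowicz system (Lindblad–Tohaneanu arXiv:2004.05664 Thm. 1 is the forward LE
  estimate in exactly these norms; Dafermos–Rodnianski–Shlapentokh-Rothman arXiv:1402.7034 for the trapping loss;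
  arXiv:2302.08916).  Why it might fail: as the crux — the observability constant may blow up through slowly damped
  quasinormal ringing as `χ → 1`, and for `|a₀|` close to `M₀` part of the photon region lies inside the near zone
  `{r ≤ 2 r₊ − M₀}`; a refutation of the stub AS TYPED by an explicit pure-gauge solution on an exactly-Kerr band would
  refute the crux itself (take `Ψ` the re-charted Kerr foliation), so the stub is not stronger than the crux in any
  way a refuter could exploit separately except through non-`π` pure-gauge fields `Def T`, `□T = 0`.

`DefectObservability_of : Sig.stub_defectIsDeformation → Sig.stub_gaugeDefectObservability → DefectObservability` is the
kernel-checked composition (real proof, no `sorry`): instantiate `T := timeCovector B Ψ`, `u := chartMetricDt B Ψ`;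
smoothness of both from `hΨ.isMetricOn` (`IsMetricOn.contDiffOn(_fderiv)`), wave gauge = `hΨ.waveTime` (the
`IsWaveTimeOn` field of the foliation), the identity = stub 1 at `(chartMetricExtend B Ψ, val '' lateRegion τ₀)`, and
`defectLE` unfolds to the set integral of `leSqDensity · (chartMetricDt B Ψ)`.  `defectObservability_of_stubs :
DefectObservability` is the crux BY NAME modulo the two stubs.  The `Sig.*` legend defs are the stub signatures
verbatim (generated from one source string each, folder `gen_birth.py`); the registered stubs are def-free and
self-contained via `open … in`.

WHY THIS CUT AND NOT A FINER ONE.  A three-way split of the analytic stub through an intermediate leaf quantity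
(middle-zone LE ≤ C·E_{k+1}(Σ_{τ₁}) ≤ C'·outer LE_{k+2}(future)) is MIS-CUT: an outgoing packet of energy `E` at radius
`R` on `Σ_{τ₁}` has unweighted leaf energy `E` but future outer-zone LE `~ E/R` (weight `(1+‖y‖)⁻²`), so the second
inequality is false; with the LE-weighted leaf energy instead, an incoming packet from radius `R` (weighted energy
`E/R`, later middle-zone deposit `E`) falsifies the first for long windows.  The crux's two-sided spacetime form dodges
both (an incoming packet crosses the far zone, contributing `∫ E (1+r)⁻² dr ~ E/(8M₀)`), so the analytic content is
registered as ONE stub; finer structure (vector-wave observability for `T` + a Korn-type recovery of `T` mod Kerr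
Killing fields from `Def T` in the outer zones) is recorded here as the natural next split, not typed.

Disproof.lean: none exists for this crux (`ledger crux ls stmt-FinalStateConjecture-18631`: no workfiles at
registration; no `_false_without_` obligations, no landed `Negative/` lemmas).  Negatives index (1 entry,
`not_UniformPhotonSphereChannels`, item stmt-FinalStateConjecture-10045): unrelated (photon-sphere channel
uniformity in Schwarzschild tortoise coordinates), no stub instantiates it.
-/

set_option linter.dupNamespace false
set_option linter.style.longLine false
set_option maxSynthPendingDepth 3

noncomputable section

open scoped Manifold ContDiff Topology ENNReal
open Filter Set Function MeasureTheory Literature.Geometry.Lorentzian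

namespace Summit.FinalStateConjecture.FinalStateConjecture.Cruxes.DefectObservability.Birth

open Summit.FinalStateConjecture.FinalStateConjecture.Theses.KillingDefectSpacetimeBound (DefectObservability)

/-! ## Legend: the two stub statements as named propositions (verbatim the registered signatures) -/

/-- Statement of `stub_defectIsDeformation`: `∂₀ g_{ji} = (Def (∂₀)♭)_{ji}` for metric components `G` on an open
`V ⊆ E4` (standard basis; `T = G(e₀, ·)`). -/
def Sig.stub_defectIsDeformation : Prop :=
  open Literature.Geometry.Lorentzian MeasureTheory Filter in open scoped ENNReal Manifold ContDiff in ∀ (G : E4 → E4 →L[ℝ] E4 →L[ℝ] ℝ) (V : Set E4), MetricCoord.IsMetricOn G V → ∀ x ∈ V, ∀ j i : Fin 4, fderiv ℝ G x (E4.basisVector 0) (E4.basisVector j) (E4.basisVector i) = MetricCoord.deform G (EuclideanSpace.basisFun (Fin 4) ℝ).toBasis (fun (y : E4) (I : Unit → Fin 4) ↦ G y (E4.basisVector 0) (E4.basisVector (I ()))) x (MetricCoord.ocons j (MetricCoord.uidx i))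

/-- Statement of `stub_gaugeDefectObservability`: backward LE observability, in the crux's frame and constants, for
every smooth `u` whose components are a pure-gauge deformation tensor `Def T`, `□_G T = 0`, on the late region. -/
def Sig.stub_gaugeDefectObservability : Prop :=
  open Literature.Geometry.Lorentzian MeasureTheory Filter in open scoped ENNReal Manifold ContDiff in ∃ k₂ : ℕ, ∀ k : ℕ, k₂ ≤ k → ∀ (Λ χ M₀ a₀ : ℝ), ∃ (δ₀ C : ℝ), 0 < δ₀ ∧ ∀ (X : Type) [TopologicalSpace X] [ChartedSpace E3 X] [IsManifold (𝓡 3) ∞ X] [T2Space X] [SecondCountableTopology X] [ConnectedSpace X], ∀ D ∈ admissibleVacuumData X, ∀ (𝒟 : VacuumCauchyDevelopment D) (τ₀ : ℝ) (Ψ : (Kerr.hypStarBackground M₀ a₀).domain → 𝒟.carrier), 𝒟.toSpacetime.IsHypKerrFoliation k Λ χ M₀ a₀ τ₀ Ψ → ∀ (T : E4 → (Unit → Fin 4) → ℝ) (u : E4 → E4 →L[ℝ] E4 →L[ℝ] ℝ), MetricCoord.TSmoothOn T (Subtype.val '' (Kerr.hypStarBackground M₀ a₀).lateRegion τ₀)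 → (∀ x ∈ (Subtype.val '' (Kerr.hypStarBackground M₀ a₀).lateRegion τ₀), ∀ I : Unit → Fin 4, MetricCoord.tlap (𝒟.toSpacetime.chartMetricExtend (Kerr.hypStarBackground M₀ a₀) Ψ) (EuclideanSpace.basisFun (Fin 4) ℝ).toBasis T x I = 0) → ContDiffOn ℝ ∞ u (Subtype.val '' (Kerr.hypStarBackground M₀ a₀).lateRegion τ₀) → (∀ x ∈ (Subtype.val '' (Kerr.hypStarBackground M₀ a₀).lateRegion τ₀), ∀ j i : Fin 4, u x (E4.basisVector j) (E4.basisVector i) = MetricCoord.deform (𝒟.toSpacetime.chartMetricExtend (Kerr.hypStarBackground M₀ a₀) Ψ) (EuclideanSpace.basisFun (Fin 4) ℝ).toBasis T x (MetricCoord.ocons j (MetricCoord.uidx i))) → ∀ τ₁ τ₂ : ℝ, τ₀ ≤ τ₁ → τ₁ + 1 ≤ τ₂ → (∀ τ ∈ Set.Icc τ₁ τ₂, 𝒟.toSpacetime.leafDev M₀ a₀ Ψ χ k τ ≤ ENNReal.ofReal δ₀) → ∫⁻ x in (Subtype.val '' (Kerr.hypStarBackground M₀ a₀).timeBand (Set.Ioo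 τ₁ τ₂)) ∩ (Kerr.outerZones M₀ a₀)ᶜ, leSqDensity k u x ≤ ENNReal.ofReal C * ∫⁻ x in (Subtype.val '' (Kerr.hypStarBackground M₀ a₀).timeBand (Set.Ioi τ₁)) ∩ Kerr.outerZones M₀ a₀, leSqDensity (k + 2) u x

/-! ## Registered stubs (`sorry` only here; signatures def-free and self-contained) -/

/-- **STUB 1 — THE STATIONARITY DEFECT IS A DEFORMATION TENSOR** (size S/M; pure index computation over
`Literature.Geometry.Lorentzian.Coord*`).  For metric components `G` on an open set `V ⊆ E4` and `x ∈ V`: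
`∂₀ G(x)(e_j, e_i) = deform G b T (x) (j, i)` with `T(y)_m = G(y)(e₀, e_m)` and `b` the standard basis, i.e.
`𝓛_{∂₀} g = ∇(∂₀)♭ + (∇(∂₀)♭)ᵗ` in coordinates.  Route: `IsMetricOn.deform_covecComp`, `kdef_apply`, `apply_chrAt`,
`koszulCLM_apply`, `IsMetricOn.symm`, `IsMetricOn.fderiv_symm` (and `EuclideanSpace.basisFun_apply` to identify
`b m = E4.basisVector m`).  [cite: Wald1984, (C.2.16)] [cite: FischerMarsdenMoncrief1980, §2] -/
theorem stub_defectIsDeformation : open Literature.Geometry.Lorentzian MeasureTheory Filter in open scoped ENNReal Manifold ContDiff in ∀ (G : E4 → E4 →L[ℝ] E4 →L[ℝ] ℝ) (V : Set E4), MetricCoord.IsMetricOn G V → ∀ x ∈ V, ∀ j i : Fin 4, fderiv ℝ G x (E4.basisVector 0) (E4.basisVector j) (E4.basisVector i) = MetricCoord.deform G (EuclideanSpace.basisFun (Fin 4) ℝ).toBasis (fun (y : E4) (I : Unit → Fin 4) ↦ G y (E4.basisVector 0) (E4.basisVector (I ()))) x (MetricCoord.ocons j (MetricCoord.uidx i))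 := by
  sorry

/-- **STUB 2 — BACKWARD LE OBSERVABILITY FOR PURE-GAUGE DEFORMATION TENSORS** (size XL; the analytic heart of K2).
With the crux's quantifier frame (`k ≥ k₂`, data `(Λ, χ, M₀, a₀)`, constants `δ₀ > 0`, `C`, a vacuum development with a
hyperboloidal Kerr-star foliation `Ψ` of order `k`, a window `[τ₁, τ₂]` of leaf deviation `≤ δ₀`): for every smooth
covector field `T` on the late region in wave gauge `□_{Ψ^*g} T = 0` and every smooth `u` whose standard-basis
components are `Def T = deform (Ψ^*g) b T`, the LE size of order `k` of `u` over the middle zone of the window is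
`≤ C ×` the LE size of order `k + 2` of `u` over the outer zones of `(τ₁, ∞)`.  Such `Def T` solve the Lichnerowicz
system in harmonic gauge (FMM 1980 Lemma 2.2 = `MetricCoord.IsMetricOn.tlap_deform_eq_of_tlap_eq_zero`, gauge
identity `IsMetricOn.trace_tcov_deform_sub_half`, vacuum `ricAt_chartMetricExtend_eq_zero`): the stub is two-sided
backward local-energy observability for pure-gauge linearised gravity on a near-sub-extremal-Kerr window, losing two
derivatives at trapping.  Why it might fail: observability constant vs. slowly damped quasinormal ringing as `χ → 1`;
photon region partly inside `{r ≤ 2r₊ − M₀}` for large spin.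
[cite: LindbladTohaneanu2020, Thm. 1 and (1.6)–(1.8)] [cite: FischerMarsdenMoncrief1980, Lemma 2.2]
[cite: DafermosRodnianskiShlapentokhrothman2014] [cite: arXiv:2302.08916] -/
theorem stub_gaugeDefectObservability : open Literature.Geometry.Lorentzian MeasureTheory Filter in open scoped ENNReal Manifold ContDiff in ∃ k₂ : ℕ, ∀ k : ℕ, k₂ ≤ k → ∀ (Λ χ M₀ a₀ : ℝ), ∃ (δ₀ C : ℝ), 0 < δ₀ ∧ ∀ (X : Type) [TopologicalSpace X] [ChartedSpace E3 X] [IsManifold (𝓡 3) ∞ X] [T2Space X] [SecondCountableTopology X] [ConnectedSpace X], ∀ D ∈ admissibleVacuumData X, ∀ (𝒟 : VacuumCauchyDevelopment D) (τ₀ : ℝ) (Ψ : (Kerr.hypStarBackground M₀ a₀).domain → 𝒟.carrier), 𝒟.toSpacetime.IsHypKerrFoliation k Λ χ M₀ a₀ τ₀ Ψ → ∀ (T : E4 → (Unit → Fin 4) → ℝ) (u : E4 → E4 →L[ℝ] E4 →L[ℝ] ℝ), MetricCoord.TSmoothOn T (Subtype.val '' (Kerr.hypStarBackground M₀ a₀).lateRegion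 τ₀) → (∀ x ∈ (Subtype.val '' (Kerr.hypStarBackground M₀ a₀).lateRegion τ₀), ∀ I : Unit → Fin 4, MetricCoord.tlap (𝒟.toSpacetime.chartMetricExtend (Kerr.hypStarBackground M₀ a₀) Ψ) (EuclideanSpace.basisFun (Fin 4) ℝ).toBasis T x I = 0) → ContDiffOn ℝ ∞ u (Subtype.val '' (Kerr.hypStarBackground M₀ a₀).lateRegion τ₀) → (∀ x ∈ (Subtype.val '' (Kerr.hypStarBackground M₀ a₀).lateRegion τ₀), ∀ j i : Fin 4, u x (E4.basisVector j) (E4.basisVector i) = MetricCoord.deform (𝒟.toSpacetime.chartMetricExtend (Kerr.hypStarBackground M₀ a₀) Ψ) (EuclideanSpace.basisFun (Fin 4) ℝ).toBasis T x (MetricCoord.ocons j (MetricCoord.uidx i))) → ∀ τ₁ τ₂ : ℝ, τ₀ ≤ τ₁ → τ₁ + 1 ≤ τ₂ → (∀ τ ∈ Set.Icc τ₁ τ₂, 𝒟.toSpacetime.leafDev M₀ a₀ Ψ χ k τ ≤ ENNReal.ofReal δ₀) → ∫⁻ x in (Subtype.val '' (Kerr.hypStarBackground M₀ a₀).timeBand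 (Set.Ioo τ₁ τ₂)) ∩ (Kerr.outerZones M₀ a₀)ᶜ, leSqDensity k u x ≤ ENNReal.ofReal C * ∫⁻ x in (Subtype.val '' (Kerr.hypStarBackground M₀ a₀).timeBand (Set.Ioi τ₁)) ∩ Kerr.outerZones M₀ a₀, leSqDensity (k + 2) u x := by
  sorry

/-! ## The composition (real proof): stubs ⇒ the crux, by name -/

/-- **K2 from the two stubs.**  Instantiate stub 2 at `T := timeCovector B Ψ = (∂₀)♭`, `u := chartMetricDt B Ψ = π`:
`T` and `u` are smooth on the late region (`hΨ.isMetricOn`), `T` is in wave gauge (`hΨ.waveTime`), the components of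
`u` are `Def T` (stub 1 at the chart metric), and `defectLE` is by definition the set integral of `leSqDensity · π`. -/
theorem DefectObservability_of :
    Sig.stub_defectIsDeformation → Sig.stub_gaugeDefectObservability → DefectObservability := by
  intro h₁ h₂
  obtain ⟨k₂, hk₂⟩ := h₂
  refine ⟨k₂, fun k hk Λ χ M₀ a₀ ↦ ?_⟩
  obtain ⟨δ₀, C, hδ₀, hC⟩ := hk₂ k hk Λ χ M₀ a₀
  refine ⟨δ₀, C, hδ₀, ?_⟩
  intro X _ _ _ _ _ _ D hD 𝒟 τ₀ Ψ hΨ τ₁ τ₂ hτ₁ hτ₂ hdev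
  have hG := hΨ.isMetricOn
  -- `π = ∂₀(Ψ^* g)` is smooth on the late region
  have hu : ContDiffOn ℝ ∞ (𝒟.toSpacetime.chartMetricDt (Kerr.hypStarBackground M₀ a₀) Ψ)
      (Subtype.val '' (Kerr.hypStarBackground M₀ a₀).lateRegion τ₀) :=
    show ContDiffOn ℝ ∞ (fun x ↦ fderiv ℝ (𝒟.toSpacetime.chartMetricExtend (Kerr.hypStarBackground M₀ a₀) Ψ) x
      (E4.basisVector 0)) (Subtype.val '' (Kerr.hypStarBackground M₀ a₀).lateRegion τ₀) from
      hG.contDiffOn_fderiv.clm_apply contDiffOn_const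
  -- the time covector `(∂₀)♭` is a smooth tensor field on the late region
  have hT : MetricCoord.TSmoothOn (𝒟.toSpacetime.timeCovector (Kerr.hypStarBackground M₀ a₀) Ψ)
      (Subtype.val '' (Kerr.hypStarBackground M₀ a₀).lateRegion τ₀) := fun I ↦
    show ContDiffOn ℝ ∞ (fun x ↦ 𝒟.toSpacetime.chartMetricExtend (Kerr.hypStarBackground M₀ a₀) Ψ x
      (E4.basisVector 0) (E4.basisVector (I ()))) (Subtype.val '' (Kerr.hypStarBackground M₀ a₀).lateRegion τ₀) from
      (hG.contDiffOn.clm_apply contDiffOn_const).clm_apply contDiffOn_const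
  -- the components of `π` are `Def (∂₀)♭` (stub 1 at the chart metric)
  have hid : ∀ x ∈ Subtype.val '' (Kerr.hypStarBackground M₀ a₀).lateRegion τ₀, ∀ j i : Fin 4,
      𝒟.toSpacetime.chartMetricDt (Kerr.hypStarBackground M₀ a₀) Ψ x (E4.basisVector j) (E4.basisVector i) =
        MetricCoord.deform (𝒟.toSpacetime.chartMetricExtend (Kerr.hypStarBackground M₀ a₀) Ψ)
          (EuclideanSpace.basisFun (Fin 4) ℝ).toBasis
          (𝒟.toSpacetime.timeCovector (Kerr.hypStarBackground M₀ a₀) Ψ) x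
          (MetricCoord.ocons j (MetricCoord.uidx i)) :=
    fun x hx j i ↦ h₁ _ _ hG x hx j i
  exact hC X D hD 𝒟 τ₀ Ψ hΨ (𝒟.toSpacetime.timeCovector (Kerr.hypStarBackground M₀ a₀) Ψ)
    (𝒟.toSpacetime.chartMetricDt (Kerr.hypStarBackground M₀ a₀) Ψ) hT hΨ.waveTime hu hid τ₁ τ₂ hτ₁ hτ₂ hdev

/-- The crux BY NAME, modulo exactly the two registered stubs. -/
theorem defectObservability_of_stubs : DefectObservability :=
  DefectObservability_of stub_defectIsDeformation stub_gaugeDefectObservability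

end Summit.FinalStateConjecture.FinalStateConjecture.Cruxes.DefectObservability.Birth

end
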